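/-
Copyright (c) 2026 the pub-hodgecm-mathlib formalisation cell (harness21).  Prover seat hodgecm-mathlib-K2E2-p13 (g0),
Track B «K2-LIT» ∕ h413 (stmt-HodgeConjecture-24833), line K2_E2 «ThetaExhaustionByRigidity», unit CAPTURE, file #13R (CLOSER):
the socket `K2E2ThetaExhaustionByRigidity.Capture.sig_K2E2CapThetaClassCaptureOriented` (= tier-0 `StubThetaClassCaptureR`) REDUCED to
the sockets `…Capture.sig_K2E2CapHolThetaWitnessOriented` (#12R) and `…L2Completeness.sig_K2E2L2MemOfProjectionRigidity` (#10, ★) —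
THETA-CLASS CAPTURE UNDER RIGIDITY, positively oriented frame.  2026-09-03.
-/
import Literature.NumberTheory.Automorphic.Liu2021.CohHolMeetsThetaLiftFromLine              -- ★ `MeetsThetaLiftFromLine`, `lineThetaKernelDatum`, `cmArchSection`
import Literature.NumberTheory.Automorphic.AdelicUnitaryGroupSpectrum                        -- ★ `isDiscretelyDecomposable_rightRegular_adelicGroupData`
import Literature.NumberTheory.Automorphic.AdelicUnitaryGroupDatum                           -- ★ `anisotropic_of_posDef_map`, `exists_infinitePlace_ne`, compactness
import Summits.HodgeConjecture.HodgeConjecture.Theorems.F0P2cSocketC                         -- ★ (C♭) currency `rhoAtLine … ιV a χ`, `HasFinComponent`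
import Summits.HodgeConjecture.HodgeConjecture.Theorems.F0P3SpectralJunction                 -- ★ generic unitary-datum `L²` junction currency
import HarnessLib

/-!
# K2_E2 road (h413 = stmt-HodgeConjecture-24833), unit CAPTURE, file #13R (CLOSER):
# theta-class capture under rigidity at a positively oriented frame —
# `sig_K2E2CapThetaClassCaptureOriented` ⟸ `sig_K2E2CapHolThetaWitnessOriented` + `sig_K2E2L2MemOfProjectionRigidity`

Cell `pub/hodgecm-mathlib` (D-0151), Track B (21-frontier RULING «PUSH BOTH» 2026-09-03, director req621∕req624, chair K2-lead,
dealer K2E2-plan), socket module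
`Summits/HodgeConjecture/HodgeConjecture/Cruxes/H413/Lines/K2_E2_ThetaExhaustionByRigidity_Capture.lean` ED. 3 (planner K2E2-plan (g0),
sha16 5f5a466f73a422d8; the R8 re-cut of 2026-09-03T21:42Z that inserted the ORIENTATION binder `ι ∈ hμ.cmType.1`), socket
**`sig_K2E2CapThetaClassCaptureOriented`** (#13R, SIGS TABLE row #13R, size S, CLOSER; = tier-0 `StubThetaClassCaptureR` of
`Cruxes/H413/Lines/K2_E2_ThetaExhaustionByRigidity.lean` ED. 4): in the TEL frame (`ι` the indefinite place, `H` definite elsewhere, `[L⁺:ℚ] ≥ 2`,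
real diagonal frame `dV` via `g`, PINNED transports `ιA` ∕ `ιV`, `[U(diag dV)]` compact, automorphic `μA`), a holomorphic-cotangent discrete `P`
with finite component `ω_H(μ, a, χ)[ιV]` — `μ` conjugate-symplectic of weight one, the frame POSITIVELY ORIENTED for `μ` (`ι ∈ Φ_μ = hμ.cmType.1`),
`a(2δ_L)⁻¹` admissible for `Φ_μ` — which is the ONLY holomorphic-cotangent discrete representation with that finite component MEETS the global theta
lift from the hermitian line `⟨a⟩` along `ιA` (★ `Liu2021.MeetsThetaLiftFromLine`: a NON-ZERO pinned theta class lies in `P.space`).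

THE MATHEMATICS ([Liu2021, proof of Prop. 4.13 Case 1 «In other words …», l. 2131–2137]; for `n = 3` [GelbartRogawski1991, Thm. 5.1.1]).
* §1 **`capThetaClassCaptureOriented_of`** — the CLOSER as a function of the two sockets it composes, taken as hypotheses at their registered types
  TOKEN FOR TOKEN: (CAP-1R) `Capture.sig_K2E2CapHolThetaWitnessOriented` (open; K2E2-p12) — for positively oriented admissible weight-one data a
  non-zero pinned theta class `θ = [Θ̃_Φ(f) ∘ ιA] ∈ L²([U(H)], μA)` all of whose discrete receivers `P′` (`pr_{P′} θ ≠ 0`) are holomorphic-cotangent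
  at `(ι, T)` with finite component `ω_H(μ, a, χ)[ιV]`; (L2-2) `L2Completeness.sig_K2E2L2MemOfProjectionRigidity` (★ PAID by
  `K2E2L2MemOfProjectionRigidity.memOfProjectionRigidity`, p854820 — discharge `hL2` by that name) — for a compact quotient with discretely
  decomposable `L²`, a class all of whose receivers equal `P` lies in `P` ([Dixmier1977, 5.4.1]).  Conclusion = `sig_K2E2CapThetaClassCaptureOriented`
  TOKEN FOR TOKEN.  Composition: by RIGIDITY every receiver of
  `θ` equals `P`; the automorphic quotient of `U(H)` is compact and `L²([U(H)], μA)` is discretely decomposable because `H` is positive definite at a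
  complex place `τ ≠ ι` (one exists as `[L:ℚ] = 2[L⁺:ℚ] ≥ 4`, ★ `UnitaryGroup.exists_infinitePlace_ne`; ★
  `compactSpace_adelicGroupData_automorphicQuotient_of_posDef`, ★ `anisotropic_of_posDef_map`, ★ `isDiscretelyDecomposable_rightRegular_adelicGroupData`
  [DeitmarEchterhoff2014, Thm. 9.2.2]); so (L2-2) puts `θ` in `P.space`, and `θ ≠ 0`: this is `MeetsThetaLiftFromLine` by definition (same
  majorants `hρ`, measure `μW`, weight `f`, Schwartz–Bruhat `Φ`, `hθ`).
* The head `capThetaClassCaptureOriented : ‹#13R›` is APPENDED to this file (append-only protocol) as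
  `capThetaClassCaptureOriented_of ‹#12R BY NAME› K2E2L2MemOfProjectionRigidity.memOfProjectionRigidity` once
  `Theorems/K2E2CapHolThetaWitnessOriented.lean` is ★; until then the tier-0 stub `stub_thetaClassCaptureR` closes MODULO #12R through §1
  (L2-2 being ★; it enters §1 as a hypothesis at its registered bytes and is discharged by the ★ name above).
No hypothesis of §1 is idle: drop (CAP-1R) and there is no theta class at all to place in `P` (the conclusion asserts a NON-ZERO vector of a specific
shape); drop (L2-2) ∕ rigidity and a differently-typed receiver could carry the whole class; the orientation binder is what makes (CAP-1R) true
([Liu2021, App. D Lem. D.2 (2)]: at `ι ∉ Φ_μ` the theta receivers are ANTIholomorphic — the R8 finding of K2E2-p12 ∕ K2E2-plan, 2026-09-03).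

HONEST LABEL: HC_CM is proved only modulo the 7 printed citations (2 remaining named inputs: hLiu418 = stmt-HodgeConjecture-24832,
h413 = stmt-HodgeConjecture-24833) until rung 0 closes; this file is a `--supports stmt-HodgeConjecture-24833` helper (it re-ties the tier-0
stub `stub_thetaClassCaptureR` modulo the socket #12R, L2-2 being ★) and retires nothing by itself.

## References
* [Liu2021] Y. Liu, *Fourier–Jacobi cycles and arithmetic relative trace formula*, Camb. J. Math. 9 (2021) = arXiv:2102.11518:
  proof of Prop. 4.13 Case 1 (l. 2129–2137, pp. 47–48); App. B §B.2 (l. 4257–4262); App. D Lem. D.2 (2).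
* [GelbartRogawski1991] S. Gelbart, J. Rogawski, *L-functions and Fourier–Jacobi coefficients for the unitary group U(3)*,
  Invent. Math. 105 (1991): Thm. 5.1.1 p. 465.
* [DeitmarEchterhoff2014] A. Deitmar, S. Echterhoff, *Principles of Harmonic Analysis*, 2nd ed., Springer (2014): Thm. 9.2.2.
* [Dixmier1977] J. Dixmier, *C\*-algebras*, North-Holland (1977): 5.4.1.
* [Rogawski1990] J. Rogawski, *Automorphic representations of unitary groups in three variables*, Ann. of Math. Stud. 123 (1990): Thm. 13.3.6.
-/

set_option autoImplicit false
-- the mandated namespace repeats the single-problem summit's segment (`HodgeConjecture.HodgeConjecture`)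
set_option linter.dupNamespace false

noncomputable section

namespace Summit.HodgeConjecture.HodgeConjecture.Cruxes.H413.K2E2CapThetaClassCaptureOriented

open scoped TensorProduct Matrix Kronecker ComplexOrder ENNReal SchwartzMap
open NumberField NumberField.InfinitePlace IsDedekindDomain MeasureTheory
open Literature.NumberTheory Literature.NumberTheory.Automorphic Literature.NumberTheory.Automorphic.UnitaryGroup
open Literature.NumberTheory.Automorphic.UnitaryGroup.CotangentForms
open Literature.NumberTheory.Automorphic.Liu2021
open Literature.NumberTheory.Automorphic.Liu2021.Def411WeilCarriers
open Literature.NumberTheory.Automorphic.Liu2021.Def411WeilCarriersDoubling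
open Literature.NumberTheory.Automorphic.IdeleClassGroup
open Literature.NumberTheory.GelbartRogawski1991 Literature.NumberTheory.GelbartRogawski1991.UnitaryDualPair
open Literature.NumberTheory.GelbartRogawski1991.UnitaryDualPair.WeilCoinv
open Literature.NumberTheory.Weil1964
open Literature.RepresentationTheory Literature.RepresentationTheory.Liu2021
open Literature.RepresentationTheory.CompactGroups
open Literature.NumberTheory.Rogawski1990
open Literature.AlgebraicGeometry.Liu2021 (IsAdmissibleElement)
open Summit.HodgeConjecture.CorCM
open Summit.HodgeConjecture.CorCM.Transposition

/-! ## §1 The closer as a function of CAP-1R and L2-2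
(`sig_K2E2CapHolThetaWitnessOriented` → `sig_K2E2L2MemOfProjectionRigidity` → `sig_K2E2CapThetaClassCaptureOriented`) -/

set_option synthInstance.maxHeartbeats 400000 in
set_option maxHeartbeats 16000000 in
/-- **Theta-class capture under rigidity at a positively oriented frame, from the holomorphic theta witness and projection rigidity.**
Hypotheses = the registered statements of `Capture.sig_K2E2CapHolThetaWitnessOriented` (#12R: for `ι ∈ Φ_μ` a non-zero pinned theta class all of
whose discrete receivers are holomorphic-cotangent with finite component `ω_H(μ, a, χ)[ιV]`) and of `L2Completeness.sig_K2E2L2MemOfProjectionRigidity`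
(L2-2, ★ `K2E2L2MemOfProjectionRigidity.memOfProjectionRigidity`: projection rigidity captures a class), token for token; conclusion =
`Capture.sig_K2E2CapThetaClassCaptureOriented` (#13R) = tier-0 `StubThetaClassCaptureR`, token for token.  Proof: rigidity makes every receiver of
the #12R class equal to `P`; `U(H)` has compact automorphic quotient and discretely decomposable `L²` (`H` definite at a complex place `τ ≠ ι`, which
exists since `[L:ℚ] = 2[L⁺:ℚ] ≥ 4`); L2-2 puts the class in `P.space`; with its non-vanishing this is `MeetsThetaLiftFromLine` by definition.
[cite: Liu2021, proof of Prop. 4.13 Case 1 (l. 2131–2137, p. 48); App. B §B.2 (l. 4257–4262)] [cite: GelbartRogawski1991, Thm. 5.1.1 p. 465]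
[cite: DeitmarEchterhoff2014, Thm. 9.2.2] [cite: Dixmier1977, 5.4.1] [cite: Rogawski1990, Thm. 13.3.6] -/
theorem capThetaClassCaptureOriented_of
    (hW :
    ∀ (L : Type) [Field L] [NumberField L] [IsCMField L] (ι : L →+* ℂ) (H : Matrix (Fin 3) (Fin 3) L) (T : GL (Fin 3) ℂ)
      (hT : (T : Matrix (Fin 3) (Fin 3) ℂ)ᴴ * H.map ι * (T : Matrix (Fin 3) (Fin 3) ℂ) = Literature.Geometry.ComplexHyperbolic.BallModel.J),
      (∀ τ' : L →+* ℂ, InfinitePlace.mk τ' ≠ InfinitePlace.mk ι → (H.map τ').PosDef) → 2 ≤ Module.finrank ℚ ↥(maximalRealSubfield L) →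
      ∀ {n' : ℕ} (e₁ : Fin 3 × Fin 1 ≃ Fin n') (dV : Fin 3 → L) (hdV : ∀ i, IsCMField.complexConj L (dV i) = dV i)
        (hdV0 : ∀ i, dV i ≠ 0) (g : GL (Fin 3) L)
        (hg : ((g : Matrix (Fin 3) (Fin 3) L).map (cmConjRingHom L))ᵀ * H * (g : Matrix (Fin 3) (Fin 3) L) = Matrix.diagonal dV)
        (ιA : (adelicGroupData (↥(maximalRealSubfield L)) L (IsCMField.complexConj L) 3 H).Adelic →*
            ↥(UnitaryGroup.adelic (↥(maximalRealSubfield L)) L (IsCMField.complexConj L) 3 (Matrix.diagonal dV))),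
          (∀ k, ((ιA k : ↥(UnitaryGroup.adelic (↥(maximalRealSubfield L)) L (IsCMField.complexConj L) 3 (Matrix.diagonal dV))) :
                GL (Fin 3) (AdeleRing (𝓞 L) L)) =
              (toAdeleGL L g)⁻¹ * adelicVal (↥(maximalRealSubfield L)) L (IsCMField.complexConj L) 3 H k * toAdeleGL L g) →
        ∀ (ιV : finAdelic (↥(maximalRealSubfield L)) L (IsCMField.complexConj L) 3 H →*
            finAdelic (↥(maximalRealSubfield L)) L (IsCMField.complexConj L) 3 (Matrix.diagonal dV)),
          (∀ k, ((ιV k : finAdelic (↥(maximalRealSubfield L)) L (IsCMField.complexConj L) 3 (Matrix.diagonal dV)) :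
              GL (Fin 3) (FiniteAdeleRing (𝓞 L) L)) =
            (toFinAdeleGL L 3 g)⁻¹ * (k : GL (Fin 3) (FiniteAdeleRing (𝓞 L) L)) * toFinAdeleGL L 3 g) →
        ∀ [CompactSpace (↥(UnitaryGroup.adelic (↥(maximalRealSubfield L)) L (IsCMField.complexConj L) 3 (Matrix.diagonal dV)) ⧸
            (UnitaryGroup.toAdelic (↥(maximalRealSubfield L)) L (IsCMField.complexConj L) 3 (Matrix.diagonal dV)).range)],
        ∀ (μA : Measure (adelicGroupData (↥(maximalRealSubfield L)) L (IsCMField.complexConj L) 3 H).automorphicQuotient)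
          [(adelicGroupData (↥(maximalRealSubfield L)) L (IsCMField.complexConj L) 3 H).IsAutomorphicMeasure μA]
          (μ : Literature.NumberTheory.Automorphic.IdeleClassGroup L →ₜ* Circle) (hμ : IsConjugateSymplectic L μ), HasWeight L μ 1 →
          ι ∈ hμ.cmType.1 →
          ∀ (a : (↥(maximalRealSubfield L))ˣ) (χ : Chi (↥(maximalRealSubfield L)) L (IsCMField.complexConj L)),
            IsAdmissibleElement L hμ.cmType.1 (algebraMap (↥(maximalRealSubfield L)) L a * (2 * imagUnit L)⁻¹) →
            letI : MeasurableSpace (↥(UnitaryGroup.adelic (↥(maximalRealSubfield L)) L (IsCMField.complexConj L) 1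
                (JW (↥(maximalRealSubfield L)) L a)) ⧸
                  (UnitaryGroup.toAdelic (↥(maximalRealSubfield L)) L (IsCMField.complexConj L) 1 (JW (↥(maximalRealSubfield L)) L a)).range) :=
              borel _
            ∃ (hρ : HasThetaMajorants fun
                (p : ↥(UnitaryGroup.adelic (↥(maximalRealSubfield L)) L (IsCMField.complexConj L) 3 (Matrix.diagonal dV)) ×
                  ↥(UnitaryGroup.adelic (↥(maximalRealSubfield L)) L (IsCMField.complexConj L) 1 (JW (↥(maximalRealSubfield L)) L a)))
                (Φ : piSchwartzBruhat (↥(maximalRealSubfield L)) (Fin n')) =>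
                  pairRep (↥(maximalRealSubfield L)) L (IsCMField.complexConj L) 3 1 e₁ (Matrix.diagonal dV) (JW (↥(maximalRealSubfield L)) L a)
                    (chiSplittingLine L e₁ dV hdV hdV0 (toHeckeCharacter L μ) (isUnitary_toHeckeCharacter L μ)
                      ((isOscillatorChar_toHeckeCharacter_iff μ).mpr hμ) (TW (↥(maximalRealSubfield L)) a)
                      (isUnit_det_TW (↥(maximalRealSubfield L)) a) (JW (↥(maximalRealSubfield L)) L a) (JW_eq (↥(maximalRealSubfield L)) L a))
                    p Φ)
              (μW : Measure (↥(UnitaryGroup.adelic (↥(maximalRealSubfield L)) L (IsCMField.complexConj L) 1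
                (JW (↥(maximalRealSubfield L)) L a)) ⧸
                  (UnitaryGroup.toAdelic (↥(maximalRealSubfield L)) L (IsCMField.complexConj L) 1 (JW (↥(maximalRealSubfield L)) L a)).range))
              (_ : IsFiniteMeasure μW)
              (_ : SMulInvariantMeasure
                (↥(UnitaryGroup.adelic (↥(maximalRealSubfield L)) L (IsCMField.complexConj L) 1 (JW (↥(maximalRealSubfield L)) L a)))
                (↥(UnitaryGroup.adelic (↥(maximalRealSubfield L)) L (IsCMField.complexConj L) 1 (JW (↥(maximalRealSubfield L)) L a)) ⧸
                  (UnitaryGroup.toAdelic (↥(maximalRealSubfield L)) L (IsCMField.complexConj L) 1 (JW (↥(maximalRealSubfield L)) L a)).range)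
                μW)
              (f : C(↥(UnitaryGroup.adelic (↥(maximalRealSubfield L)) L (IsCMField.complexConj L) 1 (JW (↥(maximalRealSubfield L)) L a)) ⧸
                (UnitaryGroup.toAdelic (↥(maximalRealSubfield L)) L (IsCMField.complexConj L) 1 (JW (↥(maximalRealSubfield L)) L a)).range, ℂ))
              (Φ : piSchwartzBruhat (↥(maximalRealSubfield L)) (Fin n'))
              (hθ : MemLp (toQuotFun (adelicGroupData (↥(maximalRealSubfield L)) L (IsCMField.complexConj L) 3 H) fun x =>
                (lineThetaKernelDatum L 3 e₁ dV hdV hdV0 μ hμ a hρ).thetaLiftFun μW Φ f (ιA x)) 2 μA),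
              MemLp.toLp _ hθ ≠ 0 ∧
              ∀ P' : DiscreteAutomorphicRep (adelicGroupData (↥(maximalRealSubfield L)) L (IsCMField.complexConj L) 3 H) μA,
                P'.space.toSubmodule.starProjection (MemLp.toLp _ hθ) ≠ 0 →
                P'.IsHolCotangentAt (cmArchSection L ι H T hT) (cmCompactFactor L ι H T hT) ∧
                P'.HasFinComponent
                  (rhoAtLine (↥(maximalRealSubfield L)) L (IsCMField.complexConj L) 3 e₁ (Matrix.diagonal dV)
                    (complexConj_imagUnit L) (imagUnit_ne_zero L) (imagUnit_mul_self L) (realDiagonal_isSymm L dV hdV)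
                    (isUnit_det_realDiagonal L dV hdV hdV0) (realDiagonal_map L dV hdV).symm
                    (fun a => isCompatible_chiSplittingLine L e₁ dV hdV hdV0 (toHeckeCharacter L μ)
                      (isUnitary_toHeckeCharacter L μ) ((isOscillatorChar_toHeckeCharacter_iff μ).mpr hμ)
                      (TW (↥(maximalRealSubfield L)) a) (isSymm_TW (↥(maximalRealSubfield L)) a)
                      (isUnit_det_TW (↥(maximalRealSubfield L)) a) (JW (↥(maximalRealSubfield L)) L a)
                      (JW_eq (↥(maximalRealSubfield L)) L a)) ιV a χ))
    (hL2 :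
    ∀ {F E : Type} [Field F] [NumberField F] [Field E] [NumberField E] [Algebra F E] {c : E ≃ₐ[F] E} {N : ℕ}
      {J : Matrix (Fin N) (Fin N) E} (μ : Measure (adelicGroupData F E c N J).automorphicQuotient)
      [(adelicGroupData F E c N J).IsAutomorphicMeasure μ] [CompactSpace (adelicGroupData F E c N J).automorphicQuotient],
      ((adelicGroupData F E c N J).rightRegular μ).IsDiscretelyDecomposable →
      ∀ (P : DiscreteAutomorphicRep (adelicGroupData F E c N J) μ) (θ : (adelicGroupData F E c N J).L2 μ),
        (∀ P' : DiscreteAutomorphicRep (adelicGroupData F E c N J) μ, P'.space.toSubmodule.starProjection θ ≠ 0 → P' = P) →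
        θ ∈ P.space.toSubmodule) :
    ∀ (L : Type) [Field L] [NumberField L] [IsCMField L] (ι : L →+* ℂ) (H : Matrix (Fin 3) (Fin 3) L) (T : GL (Fin 3) ℂ)
      (hT : (T : Matrix (Fin 3) (Fin 3) ℂ)ᴴ * H.map ι * (T : Matrix (Fin 3) (Fin 3) ℂ) = Literature.Geometry.ComplexHyperbolic.BallModel.J),
      (∀ τ' : L →+* ℂ, InfinitePlace.mk τ' ≠ InfinitePlace.mk ι → (H.map τ').PosDef) → 2 ≤ Module.finrank ℚ ↥(maximalRealSubfield L) →
      ∀ {n' : ℕ} (e₁ : Fin 3 × Fin 1 ≃ Fin n') (dV : Fin 3 → L) (hdV : ∀ i, IsCMField.complexConj L (dV i) = dV i)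
        (hdV0 : ∀ i, dV i ≠ 0) (g : GL (Fin 3) L)
        (hg : ((g : Matrix (Fin 3) (Fin 3) L).map (cmConjRingHom L))ᵀ * H * (g : Matrix (Fin 3) (Fin 3) L) = Matrix.diagonal dV)
        (ιA : (adelicGroupData (↥(maximalRealSubfield L)) L (IsCMField.complexConj L) 3 H).Adelic →*
            ↥(UnitaryGroup.adelic (↥(maximalRealSubfield L)) L (IsCMField.complexConj L) 3 (Matrix.diagonal dV))),
          (∀ k, ((ιA k : ↥(UnitaryGroup.adelic (↥(maximalRealSubfield L)) L (IsCMField.complexConj L) 3 (Matrix.diagonal dV))) :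
                GL (Fin 3) (AdeleRing (𝓞 L) L)) =
              (toAdeleGL L g)⁻¹ * adelicVal (↥(maximalRealSubfield L)) L (IsCMField.complexConj L) 3 H k * toAdeleGL L g) →
        ∀ (ιV : finAdelic (↥(maximalRealSubfield L)) L (IsCMField.complexConj L) 3 H →*
            finAdelic (↥(maximalRealSubfield L)) L (IsCMField.complexConj L) 3 (Matrix.diagonal dV)),
          (∀ k, ((ιV k : finAdelic (↥(maximalRealSubfield L)) L (IsCMField.complexConj L) 3 (Matrix.diagonal dV)) :
              GL (Fin 3) (FiniteAdeleRing (𝓞 L) L)) =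
            (toFinAdeleGL L 3 g)⁻¹ * (k : GL (Fin 3) (FiniteAdeleRing (𝓞 L) L)) * toFinAdeleGL L 3 g) →
        ∀ [CompactSpace (↥(UnitaryGroup.adelic (↥(maximalRealSubfield L)) L (IsCMField.complexConj L) 3 (Matrix.diagonal dV)) ⧸
            (UnitaryGroup.toAdelic (↥(maximalRealSubfield L)) L (IsCMField.complexConj L) 3 (Matrix.diagonal dV)).range)],
        ∀ (μA : Measure (adelicGroupData (↥(maximalRealSubfield L)) L (IsCMField.complexConj L) 3 H).automorphicQuotient)
          [(adelicGroupData (↥(maximalRealSubfield L)) L (IsCMField.complexConj L) 3 H).IsAutomorphicMeasure μA]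
          (P : DiscreteAutomorphicRep (adelicGroupData (↥(maximalRealSubfield L)) L (IsCMField.complexConj L) 3 H) μA),
          P.IsHolCotangentAt (cmArchSection L ι H T hT) (cmCompactFactor L ι H T hT) →
          ∀ (μ : Literature.NumberTheory.Automorphic.IdeleClassGroup L →ₜ* Circle) (hμ : IsConjugateSymplectic L μ), HasWeight L μ 1 →
            ι ∈ hμ.cmType.1 →
            ∀ (a : (↥(maximalRealSubfield L))ˣ) (χ : Chi (↥(maximalRealSubfield L)) L (IsCMField.complexConj L)),
              IsAdmissibleElement L hμ.cmType.1 (algebraMap (↥(maximalRealSubfield L)) L a * (2 * imagUnit L)⁻¹) →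
              P.HasFinComponent
                (rhoAtLine (↥(maximalRealSubfield L)) L (IsCMField.complexConj L) 3 e₁ (Matrix.diagonal dV)
                  (complexConj_imagUnit L) (imagUnit_ne_zero L) (imagUnit_mul_self L) (realDiagonal_isSymm L dV hdV)
                  (isUnit_det_realDiagonal L dV hdV hdV0) (realDiagonal_map L dV hdV).symm
                  (fun a => isCompatible_chiSplittingLine L e₁ dV hdV hdV0 (toHeckeCharacter L μ)
                    (isUnitary_toHeckeCharacter L μ) ((isOscillatorChar_toHeckeCharacter_iff μ).mpr hμ)
                    (TW (↥(maximalRealSubfield L)) a) (isSymm_TW (↥(maximalRealSubfield L)) a)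
                    (isUnit_det_TW (↥(maximalRealSubfield L)) a) (JW (↥(maximalRealSubfield L)) L a)
                    (JW_eq (↥(maximalRealSubfield L)) L a)) ιV a χ) →
              (∀ P' : DiscreteAutomorphicRep (adelicGroupData (↥(maximalRealSubfield L)) L (IsCMField.complexConj L) 3 H) μA,
                  P'.IsHolCotangentAt (cmArchSection L ι H T hT) (cmCompactFactor L ι H T hT) →
                  P'.HasFinComponent
                    (rhoAtLine (↥(maximalRealSubfield L)) L (IsCMField.complexConj L) 3 e₁ (Matrix.diagonal dV)
                      (complexConj_imagUnit L) (imagUnit_ne_zero L) (imagUnit_mul_self L) (realDiagonal_isSymm L dV hdV)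
                      (isUnit_det_realDiagonal L dV hdV hdV0) (realDiagonal_map L dV hdV).symm
                      (fun a => isCompatible_chiSplittingLine L e₁ dV hdV hdV0 (toHeckeCharacter L μ)
                        (isUnitary_toHeckeCharacter L μ) ((isOscillatorChar_toHeckeCharacter_iff μ).mpr hμ)
                        (TW (↥(maximalRealSubfield L)) a) (isSymm_TW (↥(maximalRealSubfield L)) a)
                        (isUnit_det_TW (↥(maximalRealSubfield L)) a) (JW (↥(maximalRealSubfield L)) L a)
                        (JW_eq (↥(maximalRealSubfield L)) L a)) ιV a χ) →
                  P' = P) →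
              MeetsThetaLiftFromLine L 3 H e₁ dV hdV hdV0 P μ hμ a ιA := by
  intro L _ _ _ ι H T hT hpos h2 n' e₁ dV hdV hdV0 g hg ιA hιA ιV hιV _ μA _ P hP μ hμ hw hι a χ hadm hPa hrig
  -- (CAP-1R) the pinned holomorphic theta class and its receivers
  obtain ⟨hρ, μW, hfin, hinv, f, Φ, hθ, hne, hrec⟩ :=
    hW L ι H T hT hpos h2 e₁ dV hdV hdV0 g hg ιA hιA ιV hιV μA μ hμ hw hι a χ hadm
  -- `U(H)`: compact automorphic quotient, discretely decomposable `L²` (`H` definite at a complex place `τ ≠ ι`)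
  have h4 : 4 ≤ Module.finrank ℚ L := by
    have h := Module.finrank_mul_finrank ℚ (↥(maximalRealSubfield L)) L
    rw [Algebra.IsQuadraticExtension.finrank_eq_two (↥(maximalRealSubfield L)) L] at h
    omega
  obtain ⟨τ, hτ⟩ := UnitaryGroup.exists_infinitePlace_ne L h4 ι
  haveI := UnitaryGroup.compactSpace_adelicGroupData_automorphicQuotient_of_posDef L 3 H τ (hpos τ hτ)
  have hdd := UnitaryGroup.isDiscretelyDecomposable_rightRegular_adelicGroupData L 3 H
    (UnitaryGroup.anisotropic_of_posDef_map L H τ (hpos τ hτ)) μA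
  -- rigidity: every receiver of the class is `P`; (L2-2, ★ by name) captures the class in `P.space`
  have hmem := hL2 μA hdd P (MemLp.toLp _ hθ) fun P' hP' => hrig P' (hrec P' hP').1 (hrec P' hP').2
  exact ⟨hρ, μW, hfin, hinv, f, Φ, hθ, hmem, hne⟩

end Summit.HodgeConjecture.HodgeConjecture.Cruxes.H413.K2E2CapThetaClassCaptureOriented

end
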